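import Summits.BirchSwinnertonDyer.BirchSwinnertonDyer.Theorems.KimAtThreeDeepLowerOffStratumLevelLoweringRibetRowsOfExists
import Literature.NumberTheory.EllipticCurves.LevelLoweringGamma0AtThreeAllPrimes
import HarnessLib

/-!
# Route `KimAtThreeKolyvagin` (rung W2), crux `DeepLowerAtThreeOffKatoStratum` (item 19679), registered
# stub `stub_nonAdditive`: ALL semistable depth-`1` rows with ONE unramified-free extra structure — EVERY
# Tamagawa-`3` prime `q`, the case `q = 3` INCLUDED — from TWELVE NAMED FACTS and the row conditions only

Cell `bsd-addord`, seat `bsd-addord-w2-acc2`, gen 5; item `stmt-BirchSwinnertonDyer-19679` (`--supports`, closes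
nothing). The `q = 3` twin of Ribet's level lowering at `3` has LANDED in the tree
(`Literature.NumberTheory.EllipticCurves.ribet1990_levelLowering_gamma0_newform_at_three_prime_three`, module
`LevelLoweringGamma0AtThreePrimeThree`, wi-76751) together with the PROVED glue
`levelLowering_gamma0_newform_at_three_all_primes` (module `LevelLoweringGamma0AtThreeAllPrimes`): the one-prime
statement with its binder `q ≠ 3` deleted. THIS FILE is the ONE application announced in `…RibetRowsOfExists`:

★★★′ `stub_nonAdditive_semistable_depthOne` — the registered stub's binders VERBATIM (level `M·q`) + `Semistable W₀`
+ «ordinary if good at `3`» + `v₃(∏ c_ℓ) ≤ 1` + `q` split multiplicative (ANY prime `q`), `q ∤ M`, `M` squarefree,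
`3 ∣ ord_q Δ`, `3 ∤ ord_ℓ Δ` (`ℓ ∣ M` prime, `ℓ ≠ 3`), `3 ∣ M → 3 ∤ ord_3 Δ` ⟹ the LOWER deep inequality of 19679,
from TWELVE NAMED FACTS (Ribet at `q ≠ 3`, its `q = 3` twin, Coleman–Edixhoven, Vatsal, Greenberg–Vatsal, Ihara,
Skinner C, modularity, GZK, Mazur, BCDT, Diamond). Planner row census: this is the whole F1 ∧ F2 slice of the
semistable depth-`1` rows — 15 624 (`q ≠ 3`) + 5 054 (`q = 3`) = 20 678 of 29 656 rows — with NOTHING displayed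
but named print. Theorems only; nothing booked; BSD is not proved by any of this.
-/

set_option autoImplicit false
-- the Theorems namespace of a single-conjunct summit repeats the summit name by design (D-0017)
set_option linter.dupNamespace false

noncomputable section

open scoped MatrixGroups ModularForm Classical NNReal

open CongruenceSubgroup WeierstrassCurve Literature.NumberTheory.EllipticCurves
  Literature.NumberTheory.EllipticCurves.ModularForms

namespace Summit.BirchSwinnertonDyer.BirchSwinnertonDyer.Theorems.KimAtThreeDeepLowerOffStratumLevelLoweringRibetRowsAllPrimes

open Summit.BirchSwinnertonDyer.BirchSwinnertonDyer.Theorems.KimAtThreeDeepLowerOffStratumLevelLoweringRibetRowsOfExists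
open Literature.NumberTheory.EllipticCurves.Rank1Residual Literature.NumberTheory.EllipticCurves.Rank1Residual.Typed
  Literature.NumberTheory.EllipticCurves.Skinner2016 Literature.NumberTheory.Automorphic

/-- ★★★′ **`stub_nonAdditive` (crux 19679 `DeepLowerAtThreeOffKatoStratum`) on ALL its SEMISTABLE depth-`1` rows whose
Tamagawa-`3` prime `q` (ANY prime, `q = 3` included) is the only bad prime at which `ρ̄_{E,3}` is unramified/finite,
from TWELVE NAMED FACTS and the ROW CONDITIONS ONLY.** One application of
`stub_nonAdditive_semistable_depthOne_of_exists_levelLoweredNewform` to the glued level-lowering theorem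
`levelLowering_gamma0_newform_at_three_all_primes` (Ribet 1990 at `q ≠ 3` + Mazur/Diamond at `q = 3`, BY NAME).
[cite: Ribet1990, Thm. 1.1] [cite: Diamond1995RefinedSerre, Thm. 6.4 and Cor. 6.5]
[cite: ColemanEdixhoven1998, Thm. 2.1] [cite: Vatsal1999, §1 (1.6), Thm. (1.13)] [cite: GreenbergVatsal2000, §3 (17)–(19)]
[cite: Ribet1984ICM, Thm. 4.1] [cite: Skinner2016PacificMC, Thm. C (§1)] [cite: Mazur1978, Cor. 4.1]
[cite: Kim2022StructureSelmer, Conj. 1.10 (PDF p. 8)] -/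
theorem stub_nonAdditive_semistable_depthOne
    (hR : ribet1990_levelLowering_gamma0_newform_at_three)
    (hR₃ : ribet1990_levelLowering_gamma0_newform_at_three_prime_three)
    (hCE : colemanEdixhoven1998_heckePolynomial_simpleRoots)
    (hV : vatsal1999_plusSymbol_congruence) (hGV : greenbergVatsal2000_plusSymbol_congruence)
    (hI : ribet1984_iharaLemma)
    (hSk : Skinner2016.thmC_padicValRat_bsd_rank_zero)
    (hmod : hasEntireLFunction_rat) (hGZK : rank_eq_analyticRank_of_analyticRank_le_one)
    (hM : mazur_not_dvd_maninConstant_of_odd)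
    (hBCDT : exists_isNewformOf) (hLL' : diamond1995_refinedSerre) :
    ∀ (W₀ : WeierstrassCurve ℚ) [W₀.IsElliptic] [W₀.IsGloballyMinimal],
      (∀ n : ℕ, W₀.HasSurjectiveModNGaloisRep (3 ^ n : ℕ)) → Finite W₀.sha →
      ∀ {M q : ℕ} [NeZero M] [NeZero q] [Fact q.Prime] [NeZero (M * q)], M * q = W₀.conductorNorm ℤ →
      ∀ (D₀ : ModularParametrizationData W₀ (M * q)),
        (∀ z ∈ D₀.L.lattice, ∃ w ∈ periodLattice D₀.f, z = D₀.c * w) →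
        (∀ (W₂ : WeierstrassCurve ℚ) [W₂.IsElliptic] (D₂ : ModularParametrizationData W₂ (M * q)),
          D₂.f = D₀.f → D₀.modularDegree ≤ D₂.modularDegree) →
        (∀ r : ℚ, ratPlusSymbol D₀.f r ≠ 0 → 0 ≤ padicValRat 3 (ratPlusSymbol D₀.f r)) →
        kuriharaVanishingOrder W₀ 3 D₀.f = 0 →
        ¬ (haveI : Fact (Nat.Prime 3) := ⟨Nat.prime_three⟩; Addv W₀ 3) →
        Semistable W₀ →
        (W₀.HasGoodReductionAtPrime 3 → ¬ (3 : ℤ) ∣ W₀.frobeniusTrace 3) →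
        padicValNat 3 W₀.tamagawaProduct ≤ 1 →
        W₀.HasSplitMultiplicativeReductionAtPrime q → ¬ q ∣ M → Squarefree M →
        (3 : ℤ) ∣ padicValRat q W₀.Δ →
        (∀ ℓ : ℕ, ℓ.Prime → ℓ ∣ M → ℓ ≠ 3 → ¬ (3 : ℤ) ∣ padicValRat ℓ W₀.Δ) →
        (3 ∣ M → ¬ (3 : ℤ) ∣ padicValRat 3 W₀.Δ) →
        ∃ d : ℕ, kuriharaPartialDeepInfty W₀ 3 D₀.f = d ∧
          kuriharaPartial W₀ 3 D₀.f 0 ≤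
            ((padicValNat 3 (Nat.card (AddCommGroup.primaryComponent W₀.sha 3)) + d : ℕ) : ℕ∞) := by
  intro W₀ _ _ htower hfin M q _ _ _ _ hN D₀ hopt hdeg hint hord hnA hsst hordinary hv hsplit hqM hMsq hqΔ hℓΔ h3Δ
  have hsurj : W₀.HasSurjectiveModNGaloisRep 3 := by simpa using htower 1
  exact stub_nonAdditive_semistable_depthOne_of_exists_levelLoweredNewform hCE hV hGV hI hSk hmod hGZK hM hBCDT hLL' W₀
    htower hfin hN D₀ hopt hdeg hint hord hnA hsst hordinary hv hsplit hqM hMsq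
    fun ι ↦ levelLowering_gamma0_newform_at_three_all_primes hR hR₃ W₀ hsurj hqM hMsq hN hsplit hqΔ hℓΔ h3Δ D₀ ι

end Summit.BirchSwinnertonDyer.BirchSwinnertonDyer.Theorems.KimAtThreeDeepLowerOffStratumLevelLoweringRibetRowsAllPrimes

end
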